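import Mathlib
import Literature.Computability.AlgebraicComplexity.CircuitDepthProofs
import Literature.Computability.AlgebraicComplexity.ArithCircuitProofs

/-!
# Crux `DivisionGap.ZeroOneTransfer` (stmt-ValiantsHypothesis-5066), line `arborescence-span` —
stub `stub_formulaToIMM`: formulas are projections of iterated matrix products

**Claim settled** (`stub_formulaToIMM`, statement `FormulaToIMM` of the lead's skeleton): over
any commutative semiring `k`, a polynomial `p` of formula size `E = formulaComplexity p` (least
size of a fan-in-two formula in the tree's list-of-gates model `ArithCircuit`) is the `(s, t)`
entry of a product `M_0 ⋯ M_{d-1}` of `w × w` matrices all of whose entries are literally a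
variable `X x` or a constant `C a`, with `w, d ≤ 4 (E + 1) ^ 4` (in fact `≤ 3 E + 1`).
Classical: Valiant 1979, §2 (series–parallel construction); Nisan 1991 (branching programs).

* Section `Programs` (any commutative semiring `R`, any label predicate `P ∋ 0, 1`): the property
  `HasProg[P, f, n]` — `f = (L.prod) s t` for a list `L` of at most `n` square matrices over
  `Fin w`, `w ≤ n`, all entries in `P`; a LOCAL NOTATION, deliberately not a definition — is
  closed under leaves, scaling by a label, products (SERIES: layers `diag(A, 1)`, a unit arc
  `E_{t₁ s₂}(1)`, layers `diag(1, B)`) and label combinations `c f + d g` (PARALLEL: source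
  layer `E_{σ s₁}(c) + E_{σ s₂}(d)`, the two programs on the diagonal blocks, sink layer
  `E_{t₁ θ}(1) + E_{t₂ θ}(1)`); blocks on `Fin a ⊕ Fin b` are moved to `Fin (a + b)`.
* Section `Weights`: `tv⟦gs⟧` (local notation) — the list of (reduced) gate weights, by the
  same left fold as `ArithCircuit.gateValues`, read through the tree's lookup
  `Operand.depthIn` (a leaf or junk forward reference weighs `1`, an in-range reference the
  weight of its gate, a gate `2 +` its operands).  `hasProg_operand`: every operand value has a
  labelled program of size its weight.  `potential` / `depthIn_output_le`: the FORMULA property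
  (`IsFormula`: every gate index is referenced at most once in `P.operands`) gives
  `weight (output) ≤ #operands + #gates ≤ 3 E + 1`.  `stub_formulaToIMM` applies this to a
  size-optimal formula (`ArithCircuit.exists_computes_size_eq_formulaComplexity`).

Unconditional (axioms `propext`, `Classical.choice`, `Quot.sound`).  References: [Valiant1979]
L. G. Valiant, *Completeness classes in algebra*, STOC 1979, §2; N. Nisan, *Lower bounds for
non-commutative computation*, STOC 1991; [Burgisser2000] P. Bürgisser, *Completeness and
Reduction in Algebraic Complexity Theory*, Def. 2.1, §2.1.
-/

-- `Summit.ValiantsHypothesis.ValiantsHypothesis.…`: mandated layout (Sub = Summit), intended.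
set_option linter.dupNamespace false

namespace Summit.ValiantsHypothesis.ValiantsHypothesis.Theorems.DivisionGapZeroOneTransfer

open Matrix MvPolynomial Literature.Computability.AlgebraicComplexity ArithCircuit

/-- `HasProg[P, f, n]` (local notation, not a definition): `f` is the `(s, t)` entry of a
product of `≤ n` square matrices of size `w ≤ n` with entries in `P` (a labelled program). -/
local notation3 "HasProg[" P ", " f ", " n "]" =>
  ∃ (w : ℕ) (L : List (Matrix (Fin w) (Fin w) _)) (s t : Fin w),
    w ≤ n ∧ List.length L ≤ n ∧ (∀ A ∈ L, ∀ i j, (P : _ → Prop) (A i j)) ∧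
      List.prod L s t = f

/-- `IsLab` (local notation, not a definition): the label predicate of the stub, literally a
variable `X x` or a constant `C a`. -/
local notation3 "IsLab" => fun q => (∃ x, q = MvPolynomial.X x) ∨ ∃ a, q = MvPolynomial.C a

namespace FormulaToIMM

section Programs

variable {R : Type*} [CommSemiring R]

/-- Monotonicity of the size bound of a labelled program. [folklore] -/
theorem hasProg_mono (P : R → Prop) {f : R} {n m : ℕ} (h : HasProg[P, f, n]) (hnm : n ≤ m) :
    HasProg[P, f, m] := by
  obtain ⟨w, L, s, t, hw, hL, hlab, hf⟩ := h
  exact ⟨w, L, s, t, hw.trans hnm, hL.trans hnm, hlab, hf⟩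

/-- A label `c` is computed by the one-layer program `(c)` of width `1`. [folklore] -/
theorem hasProg_leaf (P : R → Prop) {c : R} (hc : P c) : HasProg[P, c, 1] :=
  ⟨1, [Matrix.of fun _ _ => c], 0, 0, le_rfl, le_rfl, by simpa using hc, by simp⟩

/-- An entry `if q then c else 0` (identity / single-entry matrices) is a label. [folklore] -/
theorem lab_ite {P : R → Prop} (h0 : P 0) {c : R} (hc : P c) (q : Prop) [Decidable q] :
    P (if q then c else 0) := by
  split_ifs; exacts [hc, h0]

/-- Entries of the identity matrix are labels. [folklore] -/
theorem lab_one {P : R → Prop} (h0 : P 0) (h1 : P 1) {ι : Type*} [DecidableEq ι] (i j : ι) :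
    P ((1 : Matrix ι ι R) i j) := by
  rw [one_apply]; exact lab_ite h0 h1 _

/-- Entries of a sum of two single-entry matrices at distinct positions are labels. [folklore] -/
theorem lab_single_add_single {P : R → Prop} (h0 : P 0) {c d : R} (hc : P c) (hd : P d)
    {ι : Type*} [DecidableEq ι] {a b a' b' : ι} (hne : a ≠ a' ∨ b ≠ b') (i j : ι) :
    P ((single a b c + single a' b' d) i j) := by
  simp only [Matrix.add_apply, single_apply]
  split_ifs <;> simp_all

omit [CommSemiring R] in
/-- Entries of a block matrix are labels if the entries of the blocks are. [folklore] -/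
theorem lab_fromBlocks {P : R → Prop} {ι κ : Type*} {A : Matrix ι ι R} {B : Matrix ι κ R}
    {C : Matrix κ ι R} {D : Matrix κ κ R} (hA : ∀ i j, P (A i j)) (hB : ∀ i j, P (B i j))
    (hC : ∀ i j, P (C i j)) (hD : ∀ i j, P (D i j)) : ∀ i j, P (fromBlocks A B C D i j) := by
  rintro (i | i) (j | j) <;> simp [hA, hB, hC, hD]

variable {a b : ℕ}

/-- Product of left-embedded layers `diag(A, 1)`. [folklore] -/
theorem prod_map_inl (L : List (Matrix (Fin a) (Fin a) R)) :
    (L.map fun A => fromBlocks A 0 0 (1 : Matrix (Fin b) (Fin b) R)).prod =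
      fromBlocks L.prod 0 0 1 := by
  induction L with | nil => simp | cons A L ih => simp [ih, fromBlocks_multiply]

/-- Product of right-embedded layers `diag(1, B)`. [folklore] -/
theorem prod_map_inr (L : List (Matrix (Fin b) (Fin b) R)) :
    (L.map fun B => fromBlocks (1 : Matrix (Fin a) (Fin a) R) 0 0 B).prod =
      fromBlocks 1 0 0 L.prod := by
  induction L with | nil => simp | cons A L ih => simp [ih, fromBlocks_multiply]

/-- A labelled program on `Fin a ⊕ Fin b` is a labelled program on `Fin (a + b)`: transport
along `finSumFinEquiv` commutes with products. [folklore] -/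
theorem hasProg_of_sum (P : R → Prop) {n : ℕ}
    (L : List (Matrix (Fin a ⊕ Fin b) (Fin a ⊕ Fin b) R)) (σ θ : Fin a ⊕ Fin b)
    (hw : a + b ≤ n) (hL : L.length ≤ n) (hlab : ∀ X ∈ L, ∀ i j, P (X i j)) :
    HasProg[P, L.prod σ θ, n] := by
  have hprod : ∀ L : List (Matrix (Fin a ⊕ Fin b) (Fin a ⊕ Fin b) R),
      (L.map fun X => X.submatrix finSumFinEquiv.symm finSumFinEquiv.symm).prod =
        L.prod.submatrix (finSumFinEquiv (m := a) (n := b)).symm finSumFinEquiv.symm := by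
    intro L
    induction L with | nil => simp | cons A L ih => simp [ih]
  refine ⟨a + b, L.map fun X => X.submatrix finSumFinEquiv.symm finSumFinEquiv.symm,
    finSumFinEquiv σ, finSumFinEquiv θ, hw, by simpa using hL, ?_, by simp [hprod]⟩
  simp only [List.forall_mem_map, submatrix_apply]
  exact fun X hX i j => hlab X hX _ _

/-- The entry `(p, q)` of `X · E_{ij}(c) · Y` is `X_{pi} · c · Y_{jq}`. [folklore] -/
theorem mul_single_mul_apply {ι : Type*} [Fintype ι] [DecidableEq ι] (X Y : Matrix ι ι R)
    (i j p q : ι) (c : R) : (X * (single i j c * Y)) p q = X p i * (c * Y j q) := by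
  rw [mul_apply, Finset.sum_eq_single i (fun l _ hl => by simp [hl])
    (fun h => absurd (Finset.mem_univ i) h), single_mul_apply_same]

/-- **Series composition**: a product `f · g` of two labelled programs is a labelled program
(the first program on the first block, a unit arc, the second on the second block). [folklore] -/
theorem hasProg_mul (P : R → Prop) (h0 : P 0) (h1 : P 1) {f g : R} {n m : ℕ}
    (hf : HasProg[P, f, n]) (hg : HasProg[P, g, m]) : HasProg[P, f * g, n + m + 1] := by
  obtain ⟨a, L₁, s₁, t₁, ha, hL₁, hlab₁, rfl⟩ := hf
  obtain ⟨b, L₂, s₂, t₂, hb, hL₂, hlab₂, rfl⟩ := hg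
  set L : List (Matrix (Fin a ⊕ Fin b) (Fin a ⊕ Fin b) R) :=
    L₁.map (fun A => fromBlocks A 0 0 (1 : Matrix (Fin b) (Fin b) R)) ++
      single (Sum.inl t₁) (Sum.inr s₂) 1 ::
        L₂.map (fun B => fromBlocks (1 : Matrix (Fin a) (Fin a) R) 0 0 B) with hL
  have hv : L.prod (Sum.inl s₁) (Sum.inr t₂) = L₁.prod s₁ t₁ * L₂.prod s₂ t₂ := by
    rw [hL, List.prod_append, List.prod_cons, prod_map_inl, prod_map_inr,
      mul_single_mul_apply]
    simp
  refine hv ▸ hasProg_of_sum P L _ _ (by omega) ?_ ?_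
  · simp only [hL, List.length_append, List.length_cons, List.length_map]
    omega
  · simp only [hL, List.mem_append, List.mem_cons, List.mem_map]
    rintro X (⟨A, hA, rfl⟩ | rfl | ⟨B, hB, rfl⟩)
    · exact lab_fromBlocks (hlab₁ A hA) (fun _ _ => h0) (fun _ _ => h0) (lab_one h0 h1)
    · exact fun i j => lab_ite h0 h1 _
    · exact lab_fromBlocks (lab_one h0 h1) (fun _ _ => h0) (fun _ _ => h0) (hlab₂ B hB)

/-- **Parallel composition**: a combination `c · f + d · g` of two labelled programs with label
coefficients is a labelled program (source arcs `c`, `d` into the two blocks, unit arcs out of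
them into the sink). [folklore] -/
theorem hasProg_lin (P : R → Prop) (h0 : P 0) (h1 : P 1) {c d f g : R} {n m : ℕ} (hc : P c)
    (hd : P d) (hf : HasProg[P, f, n]) (hg : HasProg[P, g, m]) :
    HasProg[P, c * f + d * g, n + m + 2] := by
  obtain ⟨a, L₁, s₁, t₁, ha, hL₁, hlab₁, rfl⟩ := hf
  obtain ⟨b, L₂, s₂, t₂, hb, hL₂, hlab₂, rfl⟩ := hg
  set L : List (Matrix (Fin a ⊕ Fin b) (Fin a ⊕ Fin b) R) :=
    (single (Sum.inl s₁) (Sum.inl s₁) c + single (Sum.inl s₁) (Sum.inr s₂) d) ::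
      (L₁.map (fun A => fromBlocks A 0 0 (1 : Matrix (Fin b) (Fin b) R)) ++
        L₂.map (fun B => fromBlocks (1 : Matrix (Fin a) (Fin a) R) 0 0 B) ++
          [single (Sum.inl t₁) (Sum.inl t₁) 1 + single (Sum.inr t₂) (Sum.inl t₁) 1]) with hL
  have hv : L.prod (Sum.inl s₁) (Sum.inl t₁) =
      c * L₁.prod s₁ t₁ + d * L₂.prod s₂ t₂ := by
    rw [hL, List.prod_cons, List.prod_append, List.prod_append, prod_map_inl, prod_map_inr,
      List.prod_singleton]
    simp [fromBlocks_multiply, Matrix.add_mul, Matrix.mul_add, ← Matrix.mul_assoc]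
  refine hv ▸ hasProg_of_sum P L _ _ (by omega) ?_ ?_
  · simp only [hL, List.length_append, List.length_cons, List.length_map, List.length_nil]
    omega
  · simp only [hL, List.mem_cons, List.mem_append, List.mem_map, List.not_mem_nil, or_false]
    rintro X (rfl | (⟨A, hA, rfl⟩ | ⟨B, hB, rfl⟩) | rfl)
    · exact lab_single_add_single h0 hc hd (Or.inr Sum.inl_ne_inr)
    · exact lab_fromBlocks (hlab₁ A hA) (fun _ _ => h0) (fun _ _ => h0) (lab_one h0 h1)
    · exact lab_fromBlocks (lab_one h0 h1) (fun _ _ => h0) (fun _ _ => h0) (hlab₂ B hB)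
    · exact lab_single_add_single h0 h1 h1 (Or.inl Sum.inl_ne_inr)

/-- **Scaling**: `c · f` for a label `c` is a labelled program (one extra arc `c`). [folklore] -/
theorem hasProg_smul (P : R → Prop) (h0 : P 0) {c f : R} {n : ℕ} (hc : P c)
    (hf : HasProg[P, f, n]) : HasProg[P, c * f, n + 1] := by
  obtain ⟨w, L, s, t, hw, hL, hlab, rfl⟩ := hf
  refine ⟨w, single s s c :: L, s, t, by omega, by simpa using hL, ?_, ?_⟩
  · exact List.forall_mem_cons.2 ⟨fun i j => lab_ite h0 hc _, hlab⟩
  · rw [List.prod_cons, single_mul_apply_same]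

end Programs

section Weights

variable {k : Type*} {τ : Type*}

/-- `tv⟦gs⟧` (local notation, not a definition): the REDUCED WEIGHTS (weight `- 1`) of the
gates of `gs`, by the same left fold as `ArithCircuit.gateValues`.  The weight of an operand `u`
is `u.depthIn tv⟦gs⟧ + 1` (the tree's lookup `Operand.depthIn`, junk default `0`): a leaf or
junk reference weighs `1`, `gate j` the weight of gate `j`, a gate `2 +` its operands. -/
local notation3 "tv⟦" gs "⟧" => List.foldl (fun (ts : List ℕ) (g : Gate _ _) =>
  ts ++ [(List.map (fun u => Operand.depthIn ts u + 1) (Gate.args g)).sum + 1]) [] gs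

/-- One step of the fold `tv⟦·⟧`. [folklore] -/
theorem tv_append_singleton (gs : List (Gate k τ)) (g : Gate k τ) :
    tv⟦gs ++ [g]⟧ = tv⟦gs⟧ ++ [(g.args.map fun u => u.depthIn tv⟦gs⟧ + 1).sum + 1] := by
  simp [List.foldl_append]

/-- `tv⟦gs⟧` has one entry per gate. [folklore] -/
theorem tv_length (gs : List (Gate k τ)) : (tv⟦gs⟧).length = gs.length := by
  induction gs using List.reverseRecOn with
  | nil => rfl
  | append_singleton gs g ih =>
    rw [tv_append_singleton, List.length_append, List.length_singleton, ih, List.length_append,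
      List.length_singleton]

/-- Appending the reduced weight `D` of gate number `|ts|` raises the weight of exactly the
references to that gate, by `D`. [folklore] -/
theorem depthIn_append_singleton (ts : List ℕ) (D : ℕ) (u : Operand k τ) :
    u.depthIn (ts ++ [D]) = u.depthIn ts + if u.refersTo ts.length then D else 0 := by
  cases u with
  | var _ | const _ => simp [Operand.depthIn, Operand.refersTo]
  | gate j =>
    simp only [Operand.depthIn, Operand.refersTo]
    rcases Nat.lt_trichotomy j ts.length with hj | rfl | hj
    · rw [List.getD_append _ _ _ _ hj]
      simp [hj.ne]
    · rw [List.getD_append_right _ _ _ _ le_rfl, Nat.sub_self,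
        List.getD_eq_default ts 0 le_rfl, List.getD_cons_zero]
      simp
    · rw [List.getD_append_right _ _ _ _ hj.le, List.getD_eq_default _ _ (by simp; omega),
        List.getD_eq_default _ _ hj.le]
      simp [hj.ne']

/-- Summed form of `depthIn_append_singleton` over a list of operand occurrences. [folklore] -/
theorem sum_depthIn_append_singleton (ops : List (Operand k τ)) (ts : List ℕ) (D : ℕ) :
    (ops.map fun u => u.depthIn (ts ++ [D]) + 1).sum =
      (ops.map fun u => u.depthIn ts + 1).sum + D * ops.countP (Operand.refersTo ts.length) := by
  induction ops with
  | nil => simp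
  | cons u ops ih =>
    rw [List.map_cons, List.sum_cons, List.map_cons, List.sum_cons, ih, List.countP_cons,
      depthIn_append_singleton]
    split_ifs <;> ring

/-- **The potential inequality.** If every gate index is referenced at most once in `ops`
(the formula property), then `Σ_{u ∈ ops} weight u + #gates ≤ #ops + Σ_{u ∈ gate operands}
weight u + 2 · #gates` along the fold: a new gate of reduced weight `D = S + 1` raises the left
side by at most `D + 1` and the right side by at least `S + 2` (weights only grow). [folklore] -/
theorem potential (ops : List (Operand k τ)) (hF : ∀ j, ops.countP (Operand.refersTo j) ≤ 1)
    (gs : List (Gate k τ)) :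
    (ops.map fun u => u.depthIn tv⟦gs⟧ + 1).sum + gs.length ≤
      ops.length + ((gs.flatMap Gate.args).map fun u => u.depthIn tv⟦gs⟧ + 1).sum +
        2 * gs.length := by
  induction gs using List.reverseRecOn with
  | nil =>
    have h : (fun u : Operand k τ => u.depthIn ([] : List ℕ) + 1) = fun _ => 1 :=
      funext fun u => by rcases u with _ | _ | _ <;> rfl
    simp [h]
  | append_singleton gs g ih =>
    set D := (g.args.map fun u => u.depthIn tv⟦gs⟧ + 1).sum + 1 with hD
    have h3 : ((gs.flatMap Gate.args ++ g.args).map fun u => u.depthIn tv⟦gs⟧ + 1).sum ≤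
        ((gs.flatMap Gate.args ++ g.args).map fun u => u.depthIn (tv⟦gs⟧ ++ [D]) + 1).sum :=
      List.sum_le_sum fun u _ => by
        rw [depthIn_append_singleton]; exact Nat.add_le_add_right (Nat.le_add_right _ _) 1
    have hc := Nat.mul_le_mul_left D (hF gs.length)
    rw [List.map_append, List.sum_append] at h3
    rw [tv_append_singleton, ← hD, sum_depthIn_append_singleton, tv_length, List.flatMap_append,
      List.flatMap_cons, List.flatMap_nil, List.append_nil, List.length_append,
      List.length_singleton]
    omega

/-- **Size bound.** For a fan-in-two formula the weight of the output operand is at most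
`3 · size + 1` (`potential` with `ops = P.operands = gate operands ++ [output]`). [folklore] -/
theorem depthIn_output_le (P : ArithCircuit k τ) (hF : P.IsFormula) (h2 : P.IsFanInTwo) :
    P.output.depthIn tv⟦P.gates⟧ + 1 ≤ 3 * P.gates.length + 1 := by
  have hpot := potential P.operands hF P.gates
  rw [show P.operands = P.gates.flatMap Gate.args ++ [P.output] from rfl] at hpot
  simp only [List.map_append, List.sum_append, List.map_cons, List.map_nil, List.sum_cons,
    List.sum_nil, List.length_append, List.length_singleton] at hpot
  have hlen : (P.gates.flatMap Gate.args).length ≤ 2 * P.gates.length := by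
    rw [List.length_flatMap]
    have h := List.sum_le_card_nsmul (P.gates.map fun g => g.args.length) 2
      (by simpa [IsFanInTwo, Gate.fanIn] using h2)
    rw [List.length_map, smul_eq_mul] at h
    omega
  omega

variable [CommSemiring k]

/-- Variables are labels. [folklore] -/
theorem isLab_X (x : τ) : (IsLab) (X x : MvPolynomial τ k) := Or.inl ⟨x, rfl⟩

/-- Constants are labels. [folklore] -/
theorem isLab_C (a : k) : (IsLab) (C a : MvPolynomial τ k) := Or.inr ⟨a, rfl⟩

/-- `0 = C 0` is a label. [folklore] -/
theorem isLab_zero : (IsLab) (0 : MvPolynomial τ k) := Or.inr ⟨0, C_0.symm⟩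

/-- `1 = C 1` is a label. [folklore] -/
theorem isLab_one : (IsLab) (1 : MvPolynomial τ k) := Or.inr ⟨1, C_1.symm⟩

/-- **One gate** of fan-in `≤ 2`, by cases on its operands: leaves `C 0` / `C 1` (empty sum /
product), scaling (one-term sum), parallel (two-term sum), series (two-term product). [folklore] -/
theorem hasProg_gate (vals : List (MvPolynomial τ k)) (ts : List ℕ) (g : Gate k τ)
    (hg : g.fanIn ≤ 2)
    (ih : ∀ u : Operand k τ, HasProg[IsLab, u.eval vals, u.depthIn ts + 1]) :
    HasProg[IsLab, g.eval vals, (g.args.map fun u => u.depthIn ts + 1).sum + 1 + 1] := by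
  cases g with
  | sum args =>
    rcases args with _ | ⟨⟨a, u⟩, _ | ⟨⟨b, v⟩, _ | ⟨w, rest⟩⟩⟩
    · simpa [Gate.eval, Gate.args] using
        hasProg_mono (IsLab) (hasProg_leaf (IsLab) isLab_zero) one_le_two
    · have h := hasProg_smul (IsLab) isLab_zero (isLab_C a) (ih u)
      simpa [Gate.eval, Gate.args, smul_eq_C_mul] using hasProg_mono (IsLab) h (Nat.le_succ _)
    · have h := hasProg_lin (IsLab) isLab_zero isLab_one (isLab_C a) (isLab_C b) (ih u) (ih v)
      simpa [Gate.eval, Gate.args, smul_eq_C_mul, Nat.add_assoc] using h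
    · simp [Gate.fanIn, Gate.args] at hg
  | prod args =>
    rcases args with _ | ⟨u, _ | ⟨v, _ | ⟨w, rest⟩⟩⟩
    · simpa [Gate.eval, Gate.args] using
        hasProg_mono (IsLab) (hasProg_leaf (IsLab) isLab_one) one_le_two
    · simpa [Gate.eval, Gate.args] using hasProg_mono (IsLab) (ih u) (Nat.le_add_right _ 2)
    · have h := hasProg_mul (IsLab) isLab_zero isLab_one (ih u) (ih v)
      simpa [Gate.eval, Gate.args, Nat.add_assoc] using hasProg_mono (IsLab) h (Nat.le_succ _)
    · simp [Gate.fanIn, Gate.args] at hg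

/-- **All gates.** Along a fan-in-two gate list, the value of every operand has a labelled
program of size the operand's weight (induction along the left fold; a junk reference is the
leaf `C 0`; no formula property needed here). [folklore] -/
theorem hasProg_operand (gs : List (Gate k τ)) : (∀ g ∈ gs, g.fanIn ≤ 2) →
    ∀ u : Operand k τ, HasProg[IsLab, u.eval (gateValues gs), u.depthIn tv⟦gs⟧ + 1] := by
  induction gs using List.reverseRecOn with
  | nil =>
    intro _ u
    cases u with
    | var i => exact hasProg_leaf (IsLab) (isLab_X i)
    | const c => exact hasProg_leaf (IsLab) (isLab_C c)
    | gate j => exact hasProg_leaf (IsLab) isLab_zero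
  | append_singleton gs g ih =>
    intro h2 u
    have h2' : ∀ g' ∈ gs, g'.fanIn ≤ 2 := fun g' hg' => h2 g' (List.mem_append_left _ hg')
    cases u with
    | var i => exact hasProg_leaf (IsLab) (isLab_X i)
    | const c => exact hasProg_leaf (IsLab) (isLab_C c)
    | gate j =>
      rw [Operand.eval_gate, Operand.depthIn.eq_3, gateValues_append_singleton,
        tv_append_singleton]
      rcases Nat.lt_trichotomy j gs.length with hj | rfl | hj
      · rw [List.getD_append tv⟦gs⟧ _ 0 j (by rw [tv_length]; exact hj),
          List.getD_append (gateValues gs) _ 0 j (by simpa using hj)]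
        exact ih h2' (.gate j)
      · rw [List.getD_append_right tv⟦gs⟧ _ 0 _ (by rw [tv_length]),
          List.getD_append_right (gateValues gs) _ 0 _ (by simp), gateValues_length, tv_length,
          Nat.sub_self]
        simpa using hasProg_gate _ _ g (h2 g (by simp)) (ih h2')
      · rw [List.getD_eq_default _ (0 : ℕ)
            (by rw [List.length_append, List.length_singleton, tv_length]; omega),
          List.getD_eq_default _ (0 : MvPolynomial τ k) (by simp; omega)]
        exact hasProg_leaf (IsLab) isLab_zero

/-- **The program of a formula**: a fan-in-two formula `P` computes an entry of a product of
labelled matrices of width and length `≤ 3 · size + 1`. [folklore] -/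
theorem hasProg_eval (P : ArithCircuit k τ) (hF : P.IsFormula) (h2 : P.IsFanInTwo) :
    HasProg[IsLab, P.eval, 3 * P.size + 1] :=
  hasProg_mono (IsLab) (hasProg_operand P.gates h2 P.output) (depthIn_output_le P hF h2)

end Weights

end FormulaToIMM

open FormulaToIMM in
/-- **Formulas are projections of iterated matrix products** (`stub_formulaToIMM`, statement
`FormulaToIMM` of the lead's skeleton): over any commutative semiring, a polynomial `p` of
formula size `E = formulaComplexity p` is the `(s, t)` entry of a product of `d` matrices of
size `w × w` all of whose entries are literally a variable `X x` or a constant `C a`, with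
`w, d ≤ 4 (E + 1) ^ 4` (in fact `≤ 3 E + 1`): the series–parallel labelled program of a
size-optimal fan-in-two formula (`hasProg_eval`), its size bounded by the potential argument
`depthIn_output_le` (where the formula property enters). [cite: Valiant1979, §2] -/
theorem stub_formulaToIMM :
    ∀ (k : Type) [CommSemiring k] (τ : Type) (p : MvPolynomial τ k),
      ∃ (w d : ℕ) (M : Fin d → Matrix (Fin w) (Fin w) (MvPolynomial τ k)) (s t : Fin w),
        w ≤ 4 * (Literature.Computability.AlgebraicComplexity.formulaComplexity p + 1) ^ 4 ∧
        d ≤ 4 * (Literature.Computability.AlgebraicComplexity.formulaComplexity p + 1) ^ 4 ∧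
        (∀ l i j, (∃ x, M l i j = MvPolynomial.X x) ∨ (∃ a, M l i j = MvPolynomial.C a)) ∧
        p = (List.ofFn M).prod s t := by
  intro k _ τ p
  obtain ⟨P, hF, h2, hC, hs⟩ := ArithCircuit.exists_computes_size_eq_formulaComplexity p
  have hle : 3 * P.size + 1 ≤ 4 * (formulaComplexity p + 1) ^ 4 := by
    rw [← hs]
    nlinarith [Nat.le_self_pow (show (4 : ℕ) ≠ 0 by omega) (P.size + 1)]
  obtain ⟨w, L, s, t, hw, hL, hlab, hp⟩ := hasProg_mono (IsLab) (hasProg_eval P hF h2) hle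
  refine ⟨w, L.length, fun l => L[(l : ℕ)], s, t, hw, hL,
    fun l i j => hlab _ (List.getElem_mem l.isLt) i j, ?_⟩
  rw [List.ofFn_getElem, hp]
  exact hC.symm

end Summit.ValiantsHypothesis.ValiantsHypothesis.Theorems.DivisionGapZeroOneTransfer
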